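import Mathlib
import HarnessLib

/-!
# The local factor of a unitary representation of a compact group at a unitary character:
# `∫_G χ(g) ⟪φ, ρ(g)φ⟫ dμ = ‖P_χ̄ φ‖²`

Topic `RepresentationTheory/CompactGroups`; namespace `Literature.RepresentationTheory.CompactGroups` with
the grouping sub-namespace `CompactLocalFactor`. Setting: `G` a compact topological group with a finite
(Haar probability) measure `μ`, `ρ : G →* (E →L[ℂ] E)` a UNITARY representation on a complex Hilbert space
given by bounded operators (`⟪ρ g v, ρ g w⟫ = ⟪v, w⟫`, orbit maps continuous), `χ : G →* ℂ` a continuous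
UNITARY character (`‖χ g‖ = 1`). Contents (Schur orthogonality for a one-dimensional constituent):

* `isoProj μ ρ χ v = ∫ χ(g) • ρ(g) v dμ`, the `χ̄`-isotypic projector: it maps into the `χ̄`-isotypic
  vectors `IsIsotypic ρ χ v : ∀ g, ρ g v = χ̄(g) • v` (`isoProj_mem_isotypic`), fixes them
  (`isoProj_eq_self_of_mem`), is idempotent (`isoProj_idem`) and self-adjoint (`inner_isoProj_comm`);
* `localFactor μ ρ χ φ = ∫ χ(g) ⟪φ, ρ(g)φ⟫ dμ` and **the projection formula**
  `localFactor μ ρ χ φ = ‖isoProj μ ρ χ φ‖²` (`localFactor_eq_norm_sq`, `localFactor_eq_norm_sq_haar` for a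
  compact abelian group with its Haar probability measure), hence `0 ≤ re`, `≠ 0 ↔ isoProj φ ≠ 0`
  (`localFactor_re_nonneg`, `localFactor_ne_zero_iff`), and `localFactor v = ‖v‖² > 0` for a non-zero
  `χ̄`-isotypic `v` (`localFactor_eq_of_isotypic`, `localFactor_pos_of_isotypic`).

Standard: G. B. Folland, *A Course in Abstract Harmonic Analysis* (2nd ed. 2016), §5.1–5.2 (Schur
orthogonality, isotypic projections `∫ χ̄ π`); A. W. Knapp, *Representation Theory of Semisimple Groups*
(1986), Prop. 1.4 [folklore]. Everything is proved (Mathlib only).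

RELATION TO `IsotypicProjection.lean` (same directory, namespace `…CompactGroups.Isotypic`): that file treats
the same mathematics for representations given as `ω : K →* (E ≃ₗᵢ[ℂ] E)` and `Circle`-valued characters
(`proj`, `isoSub`, `integral_chi_inner_eq`); the present file is the bounded-operator / `ℂ`-valued-character
formulation (`ρ : G →* (E →L[ℂ] E)` with unitarity as a hypothesis, `χ : G →* ℂ` with `‖χ‖ = 1`), which is
the shape in which restricted unitary representations and Hecke-type characters arrive in local-factor
computations; neither API is a special case of the other by `rfl`, and the proofs here are independent.
Novelty check (`lean search --decl`, 2026-08-18): no `isoProj` / `localFactor` / `IsIsotypic` in the tree.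
Deliberately NOT here: existence of non-zero isotypic vectors, Bochner's theorem, non-compact groups.

## Provenance

Reproduced for the tree under the LEAN-IN-TREE rule (2026-08-18) from the pub-hodgecm cell's package file
`HodgeCM/PerL34/LocalFactors/CompactFactor.lean` (DAG-node prover #07 lineage, seat pv07 gen 1, gate run 19;
264 lines), statements and proofs verbatim (namespace and docstrings adapted); port by seat pv07 gen 5.
-/

set_option autoImplicit false

namespace Literature.RepresentationTheory.CompactGroups

namespace CompactLocalFactor

open MeasureTheory Complex
open scoped InnerProductSpace ComplexConjugate

variable {G : Type*} [Group G] [TopologicalSpace G] [MeasurableSpace G]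
variable {E : Type*} [NormedAddCommGroup E] [InnerProductSpace ℂ E] [CompleteSpace E]


/-- The `χ̄`-isotypic projector `P v = ∫_G χ(g) • ρ(g) v dμ(g)` (for the Haar probability measure `μ`).
[folklore] -/
noncomputable def isoProj (μ : Measure G) (ρ : G →* (E →L[ℂ] E)) (χ : G →* ℂ) (v : E) : E :=
  ∫ g, χ g • ρ g v ∂μ

/-- The local factor `I(φ) = ∫_G χ(g) · ⟪φ, ρ(g)φ⟫ dμ(g)` (Mathlib's inner product, linear in the second
variable). [folklore] -/
noncomputable def localFactor (μ : Measure G) (ρ : G →* (E →L[ℂ] E)) (χ : G →* ℂ) (φ : E) : ℂ :=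
  ∫ g, χ g * ⟪φ, ρ g φ⟫_ℂ ∂μ

/-- The `χ̄`-isotypic vectors: `ρ g v = χ̄(g) • v` for all `g`. [folklore] -/
def IsIsotypic (ρ : G →* (E →L[ℂ] E)) (χ : G →* ℂ) (v : E) : Prop :=
  ∀ g : G, ρ g v = conj (χ g) • v

section algebra

variable {ρ : G →* (E →L[ℂ] E)} {χ : G →* ℂ}

omit [TopologicalSpace G] [MeasurableSpace G] in

/-- A unitary character has `χ(g)⁻¹ = χ̄(g)` and `χ(g⁻¹) = χ̄(g)`. [folklore] -/
theorem char_inv_eq_conj (hχ1 : ∀ g, ‖χ g‖ = 1) (g : G) : χ g⁻¹ = conj (χ g) := by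
  have hne : χ g ≠ 0 := by
    intro h
    have := hχ1 g
    rw [h, norm_zero] at this
    exact zero_ne_one this
  have hmul : χ g⁻¹ * χ g = 1 := by rw [← map_mul, inv_mul_cancel, map_one]
  have : χ g⁻¹ = (χ g)⁻¹ := eq_inv_of_mul_eq_one_left hmul
  rw [this, inv_eq_conj (hχ1 g)]

omit [TopologicalSpace G] [MeasurableSpace G] in
/-- `χ(g) χ̄(g) = 1` for a unitary character. [folklore] -/
theorem char_mul_conj (hχ1 : ∀ g, ‖χ g‖ = 1) (g : G) : χ g * conj (χ g) = 1 := by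
  rw [mul_conj, normSq_eq_norm_sq, hχ1 g]
  norm_num

omit [TopologicalSpace G] [MeasurableSpace G] in
/-- `χ̄(g) χ(g) = 1` for a unitary character. [folklore] -/
theorem conj_char_mul (hχ1 : ∀ g, ‖χ g‖ = 1) (g : G) : conj (χ g) * χ g = 1 := by
  rw [mul_comm, char_mul_conj hχ1 g]

omit [TopologicalSpace G] [MeasurableSpace G] [CompleteSpace E] in
/-- Unitarity in adjoint form: `⟪ρ(g)v, w⟫ = ⟪v, ρ(g⁻¹)w⟫`. [folklore] -/
theorem inner_rep_left (hρu : ∀ g (v w : E), ⟪ρ g v, ρ g w⟫_ℂ = ⟪v, w⟫_ℂ) (g : G) (v w : E) :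
    ⟪ρ g v, w⟫_ℂ = ⟪v, ρ g⁻¹ w⟫_ℂ := by
  have hw : ρ g (ρ g⁻¹ w) = w := by
    change (ρ g * ρ g⁻¹) w = w
    rw [← map_mul, mul_inv_cancel, map_one]
    rfl
  conv_lhs => rw [← hw]
  exact hρu g v (ρ g⁻¹ w)

end algebra

section projector

variable (μ : Measure G) (ρ : G →* (E →L[ℂ] E)) (χ : G →* ℂ)

omit [CompleteSpace E] in
/-- The integrand `g ↦ χ(g) • ρ(g)v` is integrable (continuous on a compact group, finite measure).
[folklore] -/
theorem integrable_smul_rep [CompactSpace G] [OpensMeasurableSpace G] [IsFiniteMeasureOnCompacts μ]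
    (hχc : Continuous χ) (hρc : ∀ v : E, Continuous fun g : G => ρ g v) (v : E) :
    Integrable (fun g : G => χ g • ρ g v) μ :=
  (hχc.smul (hρc v)).integrable_of_hasCompactSupport (HasCompactSupport.of_compactSpace _)

omit [CompleteSpace E] in
/-- The integrand of the local factor is integrable. [folklore] -/
theorem integrable_localFactor [CompactSpace G] [OpensMeasurableSpace G]
    [IsFiniteMeasureOnCompacts μ] (hχc : Continuous χ)
    (hρc : ∀ v : E, Continuous fun g : G => ρ g v) (φ w : E) :
    Integrable (fun g : G => χ g * ⟪w, ρ g φ⟫_ℂ) μ :=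
  (hχc.mul (continuous_const.inner (hρc φ))).integrable_of_hasCompactSupport
    (HasCompactSupport.of_compactSpace _)

variable {μ ρ χ}

/-- Equivariance: `ρ(h) P v = χ̄(h) P v` — `P` maps into the `χ̄`-isotypic subspace
(left invariance of `μ`). [folklore] -/
theorem isoProj_mem_isotypic [CompactSpace G] [OpensMeasurableSpace G]
    [IsFiniteMeasureOnCompacts μ] [IsTopologicalGroup G] [MeasurableMul G]
    [μ.IsMulLeftInvariant] (hχc : Continuous χ) (hχ1 : ∀ g, ‖χ g‖ = 1)
    (hρc : ∀ v : E, Continuous fun g : G => ρ g v) (v : E) :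
    IsIsotypic ρ χ (isoProj μ ρ χ v) := by
  intro h
  rw [isoProj, ← ContinuousLinearMap.integral_comp_comm _ (integrable_smul_rep μ ρ χ hχc hρc v)]
  have hpt : ∀ g : G, ρ h (χ g • ρ g v) = conj (χ h) • (χ (h * g) • ρ (h * g) v) := by
    intro g
    have hmul : ρ h (ρ g v) = ρ (h * g) v := by
      rw [map_mul]
      rfl
    rw [ContinuousLinearMap.map_smul, hmul, map_mul χ, smul_smul, ← mul_assoc,
      conj_char_mul hχ1 h, one_mul]
  simp_rw [hpt]
  rw [integral_smul, integral_mul_left_eq_self (fun g => χ g • ρ g v) h]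

omit [TopologicalSpace G] in
/-- `P` fixes `χ̄`-isotypic vectors (probability normalisation of `μ`). [folklore] -/
theorem isoProj_eq_self_of_mem [IsProbabilityMeasure μ] (hχ1 : ∀ g, ‖χ g‖ = 1) {v : E}
    (hv : IsIsotypic ρ χ v) : isoProj μ ρ χ v = v := by
  rw [isoProj]
  have hpt : ∀ g : G, χ g • ρ g v = v := by
    intro g
    rw [hv g, smul_smul, char_mul_conj hχ1 g, one_smul]
  simp_rw [hpt]
  rw [integral_const, probReal_univ, one_smul]

/-- `P ∘ P = P`. [folklore] -/
theorem isoProj_idem [CompactSpace G] [BorelSpace G] [IsProbabilityMeasure μ]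
    [IsTopologicalGroup G] [μ.IsMulLeftInvariant] (hχc : Continuous χ) (hχ1 : ∀ g, ‖χ g‖ = 1)
    (hρc : ∀ v : E, Continuous fun g : G => ρ g v) (v : E) :
    isoProj μ ρ χ (isoProj μ ρ χ v) = isoProj μ ρ χ v :=
  isoProj_eq_self_of_mem hχ1 (isoProj_mem_isotypic hχc hχ1 hρc v)

/-- `⟪w, P v⟫ = ∫ χ(g) ⟪w, ρ(g) v⟫`. [folklore] -/
theorem inner_isoProj_right [CompactSpace G] [OpensMeasurableSpace G]
    [IsFiniteMeasureOnCompacts μ] (hχc : Continuous χ)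
    (hρc : ∀ v : E, Continuous fun g : G => ρ g v) (w v : E) :
    ⟪w, isoProj μ ρ χ v⟫_ℂ = ∫ g, χ g * ⟪w, ρ g v⟫_ℂ ∂μ := by
  rw [isoProj, ← integral_inner (integrable_smul_rep μ ρ χ hχc hρc v)]
  simp_rw [inner_smul_right]

/-- `P` is self-adjoint: `⟪P v, w⟫ = ⟪v, P w⟫` (unitarity of `ρ`, inversion invariance of `μ`).
[folklore] -/
theorem inner_isoProj_comm [CompactSpace G] [BorelSpace G] [IsFiniteMeasureOnCompacts μ]
    [IsTopologicalGroup G] [μ.IsInvInvariant] (hχc : Continuous χ) (hχ1 : ∀ g, ‖χ g‖ = 1)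
    (hρu : ∀ g (v w : E), ⟪ρ g v, ρ g w⟫_ℂ = ⟪v, w⟫_ℂ)
    (hρc : ∀ v : E, Continuous fun g : G => ρ g v) (v w : E) :
    ⟪isoProj μ ρ χ v, w⟫_ℂ = ⟪v, isoProj μ ρ χ w⟫_ℂ := by
  rw [← inner_conj_symm, inner_isoProj_right hχc hρc, inner_isoProj_right hχc hρc,
    ← integral_conj]
  have hpt : ∀ g : G, conj (χ g * ⟪w, ρ g v⟫_ℂ) = χ g⁻¹ * ⟪v, ρ g⁻¹ w⟫_ℂ := by
    intro g
    rw [map_mul, inner_conj_symm, inner_rep_left hρu, char_inv_eq_conj hχ1]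
  simp_rw [hpt]
  exact integral_inv_eq_self (fun g => χ g * ⟪v, ρ g w⟫_ℂ) μ

/-- **The projection formula** (Haar probability measure): `∫ χ(g)⟪φ, ρ(g)φ⟫ dμ = ‖P φ‖²`. [folklore] -/
theorem localFactor_eq_norm_sq [CompactSpace G] [BorelSpace G] [IsProbabilityMeasure μ]
    [IsTopologicalGroup G] [μ.IsMulLeftInvariant] [μ.IsInvInvariant] (hχc : Continuous χ)
    (hχ1 : ∀ g, ‖χ g‖ = 1) (hρu : ∀ g (v w : E), ⟪ρ g v, ρ g w⟫_ℂ = ⟪v, w⟫_ℂ)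
    (hρc : ∀ v : E, Continuous fun g : G => ρ g v) (φ : E) :
    localFactor μ ρ χ φ = ((‖isoProj μ ρ χ φ‖ ^ 2 : ℝ) : ℂ) := by
  rw [localFactor, ← inner_isoProj_right hχc hρc, ← isoProj_idem hχc hχ1 hρc φ,
    ← inner_isoProj_comm hχc hχ1 hρu hρc, isoProj_idem hχc hχ1 hρc φ, inner_self_eq_norm_sq_to_K]
  norm_cast

/-- `re I(φ) ≥ 0` (a corollary of the projection formula; no Bochner theorem). [folklore] -/
theorem localFactor_re_nonneg [CompactSpace G] [BorelSpace G] [IsProbabilityMeasure μ]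
    [IsTopologicalGroup G] [μ.IsMulLeftInvariant] [μ.IsInvInvariant] (hχc : Continuous χ)
    (hχ1 : ∀ g, ‖χ g‖ = 1) (hρu : ∀ g (v w : E), ⟪ρ g v, ρ g w⟫_ℂ = ⟪v, w⟫_ℂ)
    (hρc : ∀ v : E, Continuous fun g : G => ρ g v) (φ : E) :
    0 ≤ (localFactor μ ρ χ φ).re ∧ (localFactor μ ρ χ φ).im = 0 := by
  rw [localFactor_eq_norm_sq hχc hχ1 hρu hρc φ, ofReal_re, ofReal_im]
  exact ⟨by positivity, rfl⟩

/-- `I(φ) ≠ 0` iff the `χ̄`-isotypic component `P φ` is non-zero. [folklore] -/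
theorem localFactor_ne_zero_iff [CompactSpace G] [BorelSpace G] [IsProbabilityMeasure μ]
    [IsTopologicalGroup G] [μ.IsMulLeftInvariant] [μ.IsInvInvariant] (hχc : Continuous χ)
    (hχ1 : ∀ g, ‖χ g‖ = 1) (hρu : ∀ g (v w : E), ⟪ρ g v, ρ g w⟫_ℂ = ⟪v, w⟫_ℂ)
    (hρc : ∀ v : E, Continuous fun g : G => ρ g v) (φ : E) :
    localFactor μ ρ χ φ ≠ 0 ↔ isoProj μ ρ χ φ ≠ 0 := by
  rw [localFactor_eq_norm_sq hχc hχ1 hρu hρc φ, ne_eq, ofReal_eq_zero, pow_eq_zero_iff two_ne_zero,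
    norm_eq_zero]

omit [TopologicalSpace G] [CompleteSpace E] in
/-- A `χ̄`-isotypic vector `v` has `I(v) = ‖v‖²`. [folklore] -/
theorem localFactor_eq_of_isotypic [IsProbabilityMeasure μ] (hχ1 : ∀ g, ‖χ g‖ = 1) {v : E}
    (hv : IsIsotypic ρ χ v) :
    localFactor μ ρ χ v = ((‖v‖ ^ 2 : ℝ) : ℂ) := by
  rw [localFactor]
  have hpt : ∀ g : G, χ g * ⟪v, ρ g v⟫_ℂ = ((‖v‖ ^ 2 : ℝ) : ℂ) := by
    intro g
    rw [hv g, inner_smul_right, ← mul_assoc, char_mul_conj hχ1 g, one_mul,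
      inner_self_eq_norm_sq_to_K]
    norm_cast
  simp_rw [hpt]
  rw [integral_const, probReal_univ, one_smul]

omit [TopologicalSpace G] [CompleteSpace E] in
/-- A non-zero `χ̄`-isotypic vector `v` has `0 < re I(v)` (`I(v) = ‖v‖²`). [folklore] -/
theorem localFactor_pos_of_isotypic [IsProbabilityMeasure μ] (hχ1 : ∀ g, ‖χ g‖ = 1) {v : E}
    (hv : IsIsotypic ρ χ v) (hv0 : v ≠ 0) :
    0 < (localFactor μ ρ χ v).re := by
  rw [localFactor_eq_of_isotypic hχ1 hv, ofReal_re]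
  exact pow_pos (norm_pos_iff.mpr hv0) 2

end projector

/-! ### The compact abelian case (all invariances inferred by Mathlib) -/

/-- For a compact ABELIAN group with its Haar probability measure every hypothesis on `μ` above is
automatic. [folklore] -/
theorem localFactor_eq_norm_sq_haar {A : Type*} [CommGroup A] [TopologicalSpace A]
    [IsTopologicalGroup A] [CompactSpace A] [MeasurableSpace A] [BorelSpace A]
    (μ : Measure A) [μ.IsHaarMeasure] [IsProbabilityMeasure μ]
    (ρ : A →* (E →L[ℂ] E)) (χ : A →* ℂ) (hχc : Continuous χ) (hχ1 : ∀ g, ‖χ g‖ = 1)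
    (hρu : ∀ g (v w : E), ⟪ρ g v, ρ g w⟫_ℂ = ⟪v, w⟫_ℂ)
    (hρc : ∀ v : E, Continuous fun g : A => ρ g v) (φ : E) :
    localFactor μ ρ χ φ = ((‖isoProj μ ρ χ φ‖ ^ 2 : ℝ) : ℂ) :=
  localFactor_eq_norm_sq hχc hχ1 hρu hρc φ

end CompactLocalFactor

end Literature.RepresentationTheory.CompactGroups
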